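import Summits.CriticalPhenomena.PercolationContinuityZ3.Theorems.PercNearOneGluingNoHeavyLowerTailOneCutFiveThreePortStars
import Summits.CriticalPhenomena.PercolationContinuityZ3.Theorems.PercNearOneGluingNoHeavyLowerTailOneCutFiveThreePortCells
import Summits.CriticalPhenomena.PercolationContinuityZ3.Theorems.PercNearOneGluingNoHeavyLowerTailOneCutFiveExchangeSym
import Mathlib.Tactic.Linarith
import Mathlib.Tactic.Ring
import HarnessLib

/-!
# `NoHeavyLowerTail` (stmt-CriticalPhenomena-4575), |A| = 5 glued rung — `Z(3,2)` at a THREE-PORT observer: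
# exact cells, the heavy-hair theorem, and the three-point row that `Z(3,2)` implies (part 3)

Support file (prover seat `prim-ineq-gen-8`, gen 9; `--supports stmt-CriticalPhenomena-4575`).  No definitions, no named
facts, no sorries.  Memo: `run/shared/lean/prim/prim-ineq-gen-8/FINDING-gen9-THREEPORT.md`.

SETTING.  `μ = prodBernoulli w` on `Fin n`; `o` a three-port observer onto distinct targets `a, b, c ≠ o` (every other pair at
`o` has weight `0`), hairs `α = w(o,a)`, `β = w(o,b)`, `γ = w(o,c)`, graph off `o` arbitrary; `x ~' y` = joined off `o`; the
three-point law off `o`: `U3 = μ(a~'b, a~'c)`, `Uab = μ(a~'b, a≁'c)`, `Uac = μ(a~'c, a≁'b)`, `Ubc = μ(b~'c, a≁'b)`,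
`U0 = μ(a≁'b, a≁'c, b≁'c)`; `Z(3,2)` = the open row `OneCutFive.ZeroOneThree` (`Σ_v μ(o↔v) > 2 ⟹ μ(B={a}) ≤ μ(B={b,c})`).

RESULTS.
* Exact formulas (`real_single`, `real_pair`, `real_openConn`, `_b`, `_c`):
  `μ(B={a}) = α(1−β)(1−γ)(Ubc+U0)`, `μ(B={b,c}) = (1−α)(βγ·U0 + (β+γ−βγ)·Ubc)`,
  `μ(o↔a) = α + (1−α)(β·Uab + γ·Uac + (β+γ−βγ)·U3)` (cyclically); hence the MARGIN IDENTITY (`margin_eq`)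
  `μ(B={b,c}) − μ(B={a}) = U0·[(1−α)βγ − α(1−β)(1−γ)] + Ubc·[β+γ−βγ−α]`.
* HEAVY-HAIR THEOREM (`pocketExchange_of_half_le_hair`): if some hair is `≥ 1/2`, the conclusion of `Z(3,2)` holds at the
  weakest vertex with NO hypothesis on `Σ_v μ(o↔v)` (pure algebra at the lightest hair + Kozma–Nitzan's transfer
  `OneCutFive.pocketExchange_of_le_of_exchange`).  So at a three-port observer `Z(3,2)` is open only with all hairs `< 1/2`.
* NECESSITY (`zeroOneThree_threePort`, `zeroOneThree_threePoint_row`): `ZeroOneThree` implies, for EVERY finite weighted graph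
  and hair triple, the closed-form three-point inequality `[Σ>2, q_a ≤ q_b, q_a ≤ q_c] ⟹ U0·T_a + Ubc·(β+γ−βγ−α) ≥ 0`.
  For hairs `≈ (.44,.24,.24)`, `U3 ≈ 1` this is an apex-pair LOWER bound `Uab + Uac ≳ c·U0` (`c ≈ 0.05–0.2` depending on
  `Ubc`), a LINEAR-rate form of Gladkov's open Conjecture 10.1, where the printed (tree-proved) rate is cubic
  (`gladkov2024_thm_1_3_rate_max`) [cite: Gladkov2024, Thm. 1.3 (p. 2), Conj. 10.1 (p. 18)]; the known rows (GZ24 Thm 4.6,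
  Gladkov L1.2, Harris, 3PT-LB) admit pseudo-laws violating it (memo §2), no graph is known to.
HONEST LABEL: `Z(3,2)` itself is OPEN; the necessity theorems are conditional on it and assert nothing about it. -/

noncomputable section

namespace Summit.CriticalPhenomena.PercolationContinuityZ3.Theorems

open MeasureTheory Set Literature.Probability.LatticeModels Literature.Probability.Percolation
open scoped Classical BigOperators

variable {n : ℕ}

namespace ThreePort

/-! ### The exact formulas -/

section Formulas

variable (w : Sym2 (Fin n) → unitInterval) (o a b c : Fin n) (hao : a ≠ o) (hbo : b ≠ o) (hco : c ≠ o)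
  (hab : a ≠ b) (hac : a ≠ c) (hbc : b ≠ c) (hobs : ∀ u, u ≠ o → u ≠ a → u ≠ b → u ≠ c → w s(o, u) = 0)
include hao hbo hco hab hac hbc hobs

/-- **`μ(o ↔ a only) = α(1−β)(1−γ)·(Ubc + U0)`** at a three-port observer: `o` reaches exactly `a` iff the hair to `a`
is the only open hair and `a` is `H`-separated from `b` and `c`. [this work] -/
theorem real_single :
    (prodBernoulli w).real {ω | ω ∈ openConn o a ∧ ω ∉ openConn o b ∧ ω ∉ openConn o c} =
      w s(o, a) * (1 - w s(o, b)) * (1 - w s(o, c)) *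
        ((prodBernoulli w).real {ω | (openGraph (ω ∩ {e | o ∉ e})).Reachable b c ∧
            ¬ (openGraph (ω ∩ {e | o ∉ e})).Reachable a b} +
          (prodBernoulli w).real {ω | ¬ (openGraph (ω ∩ {e | o ∉ e})).Reachable a b ∧
            ¬ (openGraph (ω ∩ {e | o ∉ e})).Reachable a c ∧ ¬ (openGraph (ω ∩ {e | o ∉ e})).Reachable b c}) := by
  have h := real_setOf_eq_sum w o a b c hao hbo hco hobs (fun A B C => A ∧ ¬ B ∧ ¬ C)
  rw [h, sum_powerset_three a b c hab hac hbc]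
  obtain ⟨e0, ea, eb, ec, eab, eac, ebc, eabc⟩ := real_starEvent_eight w o a b c hao hbo hco hab hac hbc hobs
  rw [e0, ea, eb, ec, eab, eac, ebc, eabc]
  have hrefl : ∀ (ξ : BondConfig (Fin n)) (x : Fin n), (openGraph ξ).Reachable x x :=
    fun ξ x => SimpleGraph.Reachable.refl x
  simp only [Finset.notMem_empty, false_and, exists_false, not_false_eq_true, and_true, and_self,
    Set.setOf_false, measureReal_empty, mul_zero, zero_add, add_zero, Finset.mem_singleton, exists_eq_left, hrefl,
    true_and, not_true_eq_false, and_false, Finset.mem_insert, exists_eq_or_imp, or_true, true_or]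
  rw [real_notR_notR (prodBernoulli w) (fun ξ => openGraph (ξ ∩ {e | o ∉ e})) a b c]


/-- **`μ(o ↔ b, o ↔ c, o ↮ a) = (1−α)(βγ·U0 + (β+γ−βγ)·Ubc)`** at a three-port observer. [this work] -/
theorem real_pair :
    (prodBernoulli w).real {ω | ω ∉ openConn o a ∧ ω ∈ openConn o b ∧ ω ∈ openConn o c} =
      (1 - w s(o, a)) * (w s(o, b) * w s(o, c) *
          (prodBernoulli w).real {ω | ¬ (openGraph (ω ∩ {e | o ∉ e})).Reachable a b ∧
            ¬ (openGraph (ω ∩ {e | o ∉ e})).Reachable a c ∧ ¬ (openGraph (ω ∩ {e | o ∉ e})).Reachable b c} +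
        (w s(o, b) + w s(o, c) - w s(o, b) * w s(o, c)) *
          (prodBernoulli w).real {ω | (openGraph (ω ∩ {e | o ∉ e})).Reachable b c ∧
            ¬ (openGraph (ω ∩ {e | o ∉ e})).Reachable a b}) := by
  have h := real_setOf_eq_sum w o a b c hao hbo hco hobs (fun A B C => ¬ A ∧ B ∧ C)
  rw [h, sum_powerset_three a b c hab hac hbc]
  obtain ⟨e0, ea, eb, ec, eab, eac, ebc, eabc⟩ := real_starEvent_eight w o a b c hao hbo hco hab hac hbc hobs
  rw [e0, ea, eb, ec, eab, eac, ebc, eabc]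
  have hrefl : ∀ (ξ : BondConfig (Fin n)) (x : Fin n), (openGraph ξ).Reachable x x :=
    fun ξ x => SimpleGraph.Reachable.refl x
  simp only [Finset.notMem_empty, false_and, exists_false, not_false_eq_true, and_true, and_self,
    Set.setOf_false, measureReal_empty, mul_zero, zero_add, add_zero, Finset.mem_singleton, exists_eq_left, hrefl,
    true_and, not_true_eq_false, and_false, Finset.mem_insert, exists_eq_or_imp, or_true, true_or]
  simp only [not_or] 
  rw [real_notRba_Rbc (prodBernoulli w) (fun ξ => openGraph (ξ ∩ {e | o ∉ e})) a b c,
    real_notRca_Rcb (prodBernoulli w) (fun ξ => openGraph (ξ ∩ {e | o ∉ e})) a b c,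
    real_notR_notR' (prodBernoulli w) (fun ξ => openGraph (ξ ∩ {e | o ∉ e})) a b c]
  ring

/-- **`μ(o ↔ a) = α + (1−α)(β·Uab + γ·Uac + (β+γ−βγ)·U3)`** at a three-port observer. [this work] -/
theorem real_openConn :
    (prodBernoulli w).real (openConn o a) =
      w s(o, a) + (1 - w s(o, a)) * (w s(o, b) *
          (prodBernoulli w).real {ω | (openGraph (ω ∩ {e | o ∉ e})).Reachable a b ∧
            ¬ (openGraph (ω ∩ {e | o ∉ e})).Reachable a c} +
        w s(o, c) * (prodBernoulli w).real {ω | (openGraph (ω ∩ {e | o ∉ e})).Reachable a c ∧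
            ¬ (openGraph (ω ∩ {e | o ∉ e})).Reachable a b} +
        (w s(o, b) + w s(o, c) - w s(o, b) * w s(o, c)) *
          (prodBernoulli w).real {ω | (openGraph (ω ∩ {e | o ∉ e})).Reachable a b ∧
            (openGraph (ω ∩ {e | o ∉ e})).Reachable a c}) := by
  have h := real_setOf_eq_sum w o a b c hao hbo hco hobs (fun A _ _ => A)
  have h0 : (openConn o a : Set (BondConfig (Fin n))) = {ω | ω ∈ openConn o a} := rfl
  rw [h0, h, sum_powerset_three a b c hab hac hbc]
  obtain ⟨e0, ea, eb, ec, eab, eac, ebc, eabc⟩ := real_starEvent_eight w o a b c hao hbo hco hab hac hbc hobs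
  rw [e0, ea, eb, ec, eab, eac, ebc, eabc]
  have hrefl : ∀ (ξ : BondConfig (Fin n)) (x : Fin n), (openGraph ξ).Reachable x x :=
    fun ξ x => SimpleGraph.Reachable.refl x
  simp only [Finset.notMem_empty, false_and, exists_false, Set.setOf_false, measureReal_empty, mul_zero, zero_add,
    Finset.mem_singleton, exists_eq_left, hrefl, Finset.mem_insert, exists_eq_or_imp, true_or, Set.setOf_true,
    probReal_univ, mul_one]
  rw [real_Rba (prodBernoulli w) (fun ξ => openGraph (ξ ∩ {e | o ∉ e})) a b c,
    real_Rca (prodBernoulli w) (fun ξ => openGraph (ξ ∩ {e | o ∉ e})) a b c,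
    real_Rba_or_Rca (prodBernoulli w) (fun ξ => openGraph (ξ ∩ {e | o ∉ e})) a b c]
  ring

/-- **`μ(o ↔ b) = β + (1−β)(α·Uab + γ·Ubc + (α+γ−αγ)·U3)`** at a three-port observer (cells in the `a`-based
dictionary). [this work] -/
theorem real_openConn_b :
    (prodBernoulli w).real (openConn o b) =
      w s(o, b) + (1 - w s(o, b)) * (w s(o, a) *
          (prodBernoulli w).real {ω | (openGraph (ω ∩ {e | o ∉ e})).Reachable a b ∧
            ¬ (openGraph (ω ∩ {e | o ∉ e})).Reachable a c} +
        w s(o, c) * (prodBernoulli w).real {ω | (openGraph (ω ∩ {e | o ∉ e})).Reachable b c ∧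
            ¬ (openGraph (ω ∩ {e | o ∉ e})).Reachable a b} +
        (w s(o, a) + w s(o, c) - w s(o, a) * w s(o, c)) *
          (prodBernoulli w).real {ω | (openGraph (ω ∩ {e | o ∉ e})).Reachable a b ∧
            (openGraph (ω ∩ {e | o ∉ e})).Reachable a c}) := by
  have h := real_setOf_eq_sum w o a b c hao hbo hco hobs (fun _ B _ => B)
  have h0 : (openConn o b : Set (BondConfig (Fin n))) = {ω | ω ∈ openConn o b} := rfl
  rw [h0, h, sum_powerset_three a b c hab hac hbc]
  obtain ⟨e0, ea, eb, ec, eab, eac, ebc, eabc⟩ := real_starEvent_eight w o a b c hao hbo hco hab hac hbc hobs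
  rw [e0, ea, eb, ec, eab, eac, ebc, eabc]
  have hrefl : ∀ (ξ : BondConfig (Fin n)) (x : Fin n), (openGraph ξ).Reachable x x :=
    fun ξ x => SimpleGraph.Reachable.refl x
  simp only [Finset.notMem_empty, false_and, exists_false, Set.setOf_false, measureReal_empty, mul_zero, zero_add,
    Finset.mem_singleton, exists_eq_left, hrefl, Finset.mem_insert, exists_eq_or_imp, or_true, true_or, Set.setOf_true,
    probReal_univ, mul_one]
  rw [real_Rab (prodBernoulli w) (fun ξ => openGraph (ξ ∩ {e | o ∉ e})) a b c,
    real_Rcb (prodBernoulli w) (fun ξ => openGraph (ξ ∩ {e | o ∉ e})) a b c,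
    real_Rab_or_Rcb (prodBernoulli w) (fun ξ => openGraph (ξ ∩ {e | o ∉ e})) a b c]
  ring

/-- **`μ(o ↔ c) = γ + (1−γ)(α·Uac + β·Ubc + (α+β−αβ)·U3)`** at a three-port observer (cells in the `a`-based
dictionary). [this work] -/
theorem real_openConn_c :
    (prodBernoulli w).real (openConn o c) =
      w s(o, c) + (1 - w s(o, c)) * (w s(o, a) *
          (prodBernoulli w).real {ω | (openGraph (ω ∩ {e | o ∉ e})).Reachable a c ∧
            ¬ (openGraph (ω ∩ {e | o ∉ e})).Reachable a b} +
        w s(o, b) * (prodBernoulli w).real {ω | (openGraph (ω ∩ {e | o ∉ e})).Reachable b c ∧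
            ¬ (openGraph (ω ∩ {e | o ∉ e})).Reachable a b} +
        (w s(o, a) + w s(o, b) - w s(o, a) * w s(o, b)) *
          (prodBernoulli w).real {ω | (openGraph (ω ∩ {e | o ∉ e})).Reachable a b ∧
            (openGraph (ω ∩ {e | o ∉ e})).Reachable a c}) := by
  have h := real_setOf_eq_sum w o a b c hao hbo hco hobs (fun _ _ C => C)
  have h0 : (openConn o c : Set (BondConfig (Fin n))) = {ω | ω ∈ openConn o c} := rfl
  rw [h0, h, sum_powerset_three a b c hab hac hbc]
  obtain ⟨e0, ea, eb, ec, eab, eac, ebc, eabc⟩ := real_starEvent_eight w o a b c hao hbo hco hab hac hbc hobs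
  rw [e0, ea, eb, ec, eab, eac, ebc, eabc]
  have hrefl : ∀ (ξ : BondConfig (Fin n)) (x : Fin n), (openGraph ξ).Reachable x x :=
    fun ξ x => SimpleGraph.Reachable.refl x
  simp only [Finset.notMem_empty, false_and, exists_false, Set.setOf_false, measureReal_empty, mul_zero, zero_add,
    Finset.mem_singleton, exists_eq_left, hrefl, Finset.mem_insert, exists_eq_or_imp, or_true, Set.setOf_true,
    probReal_univ, mul_one]
  rw [real_Rac (prodBernoulli w) (fun ξ => openGraph (ξ ∩ {e | o ∉ e})) a b c,
    real_Rbc (prodBernoulli w) (fun ξ => openGraph (ξ ∩ {e | o ∉ e})) a b c,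
    real_Rac_or_Rbc (prodBernoulli w) (fun ξ => openGraph (ξ ∩ {e | o ∉ e})) a b c]
  ring


/-! ### The margin identity, the heavy-hair theorem, and the three-point row implied by `Z(3,2)` -/

/-- **Margin identity at a three-port observer**: `μ(B={b,c}) − μ(B={a}) = U0·[(1−α)βγ − α(1−β)(1−γ)] + Ubc·[β+γ−βγ−α]`
(`B` = the set of targets joined to `o`).  The two summands are the contributions of the off-`o` scenes `a|b|c`
(three independent hairs into three different clusters) and `a|bc` (`b, c` already joined off `o`); the scenes `ab|c`,
`ac|b`, `abc` contribute nothing to this margin. [this work] -/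
theorem margin_eq :
    (prodBernoulli w).real {ω | ω ∉ openConn o a ∧ ω ∈ openConn o b ∧ ω ∈ openConn o c} -
        (prodBernoulli w).real {ω | ω ∈ openConn o a ∧ ω ∉ openConn o b ∧ ω ∉ openConn o c} =
      (prodBernoulli w).real {ω | ¬ (openGraph (ω ∩ {e | o ∉ e})).Reachable a b ∧
          ¬ (openGraph (ω ∩ {e | o ∉ e})).Reachable a c ∧ ¬ (openGraph (ω ∩ {e | o ∉ e})).Reachable b c} *
          ((1 - w s(o, a)) * w s(o, b) * w s(o, c) - w s(o, a) * (1 - w s(o, b)) * (1 - w s(o, c))) +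
        (prodBernoulli w).real {ω | (openGraph (ω ∩ {e | o ∉ e})).Reachable b c ∧
          ¬ (openGraph (ω ∩ {e | o ∉ e})).Reachable a b} *
          (w s(o, b) + w s(o, c) - w s(o, b) * w s(o, c) - w s(o, a)) := by
  rw [real_pair w o a b c hao hbo hco hab hac hbc hobs, real_single w o a b c hao hbo hco hab hac hbc hobs]
  ring

/-- **Heavy-hair theorem (core form).**  At a three-port observer, if the hair to `a` is the lightest
(`α ≤ β`, `α ≤ γ`) and one of the other two hairs weighs at least `1/2`, then `μ(B={a}) ≤ μ(B={b,c})` — with NO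
hypothesis on `Σ_v μ(o↔v)` and nothing assumed about the graph off `o`.  Pure algebra on `margin_eq`:
`(1−α)βγ − α(1−β)(1−γ) = γ(β−α) + α(1−β)(2γ−1) = β(γ−α) + α(1−γ)(2β−1)` and `β+γ−βγ−α = (β−α) + γ(1−β)`.
[this work] -/
theorem single_le_pair_of_half_le (hαβ : (w s(o, a) : ℝ) ≤ w s(o, b)) (hαγ : (w s(o, a) : ℝ) ≤ w s(o, c))
    (hhalf : (1 / 2 : ℝ) ≤ w s(o, b) ∨ (1 / 2 : ℝ) ≤ w s(o, c)) :
    (prodBernoulli w).real {ω | ω ∈ openConn o a ∧ ω ∉ openConn o b ∧ ω ∉ openConn o c} ≤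
      (prodBernoulli w).real {ω | ω ∉ openConn o a ∧ ω ∈ openConn o b ∧ ω ∈ openConn o c} := by
  have hm := margin_eq w o a b c hao hbo hco hab hac hbc hobs
  set α : ℝ := (w s(o, a) : ℝ) with hα
  set β : ℝ := (w s(o, b) : ℝ) with hβ
  set γ : ℝ := (w s(o, c) : ℝ) with hγ
  have hα0 : 0 ≤ α := (w s(o, a)).2.1
  have hβ1 : β ≤ 1 := (w s(o, b)).2.2
  have hγ0 : 0 ≤ γ := (w s(o, c)).2.1
  have hγ1 : γ ≤ 1 := (w s(o, c)).2.2
  have hβ0 : 0 ≤ β := (w s(o, b)).2.1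
  have hU0 : 0 ≤ (prodBernoulli w).real {ω | ¬ (openGraph (ω ∩ {e | o ∉ e})).Reachable a b ∧
      ¬ (openGraph (ω ∩ {e | o ∉ e})).Reachable a c ∧ ¬ (openGraph (ω ∩ {e | o ∉ e})).Reachable b c} :=
    measureReal_nonneg
  have hUbc : 0 ≤ (prodBernoulli w).real {ω | (openGraph (ω ∩ {e | o ∉ e})).Reachable b c ∧
      ¬ (openGraph (ω ∩ {e | o ∉ e})).Reachable a b} := measureReal_nonneg
  have hT : 0 ≤ (1 - α) * β * γ - α * (1 - β) * (1 - γ) := by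
    rcases hhalf with h | h
    · have e : (1 - α) * β * γ - α * (1 - β) * (1 - γ) = β * (γ - α) + α * (1 - γ) * (2 * β - 1) := by ring
      rw [e]
      have h1 : 0 ≤ β * (γ - α) := mul_nonneg hβ0 (by linarith)
      have h2 : 0 ≤ α * (1 - γ) * (2 * β - 1) := mul_nonneg (mul_nonneg hα0 (by linarith)) (by linarith)
      linarith
    · have e : (1 - α) * β * γ - α * (1 - β) * (1 - γ) = γ * (β - α) + α * (1 - β) * (2 * γ - 1) := by ring
      rw [e]
      have h1 : 0 ≤ γ * (β - α) := mul_nonneg hγ0 (by linarith)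
      have h2 : 0 ≤ α * (1 - β) * (2 * γ - 1) := mul_nonneg (mul_nonneg hα0 (by linarith)) (by linarith)
      linarith
  have hP : 0 ≤ β + γ - β * γ - α := by
    have e : β + γ - β * γ - α = (β - α) + γ * (1 - β) := by ring
    rw [e]
    have h1 : 0 ≤ γ * (1 - β) := mul_nonneg hγ0 (by linarith)
    linarith
  have h1 := mul_nonneg hU0 hT
  have h2 := mul_nonneg hUbc hP
  linarith

omit hao hbo hco hab hac hbc hobs in
/-- **Heavy-hair theorem.**  `μ = prodBernoulli w` on `Fin n`; `o` a three-port observer onto `{a,b,c}` (distinct,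
`≠ o`, every other pair at `o` of weight `0`), the graph off `o` ARBITRARY.  If some hair weighs at least `1/2`, then
the pocket exchange `μ(B={a}) ≤ μ(B={b,c})` holds at the weakest vertex `a` (`μ(o↔a) ≤ μ(o↔b), μ(o↔c)`) — the
conclusion of `Z(3,2)` (`OneCutFive.ZeroOneThree`) WITHOUT its hypothesis `Σ_v μ(o↔v) > 2`.  (Core form at the
lightest hair, then Kozma–Nitzan's transfer `OneCutFive.pocketExchange_of_le_of_exchange` to the weakest vertex.)
So at a three-port observer `Z(3,2)` is open only when all three hairs are `< 1/2`; there `Σ > 2` forces the off-`o`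
cell `U3 = μ(a ~' b ~' c)` to be large, and the statement becomes a three-point inequality (`zeroOneThree_threePort_row`).
[this work; cite: KozmaNitzan2024, proof of Theorem 2, display (7) (p. 8)] -/
theorem pocketExchange_of_half_le_hair (w : Sym2 (Fin n) → unitInterval) (o a b c : Fin n) (hao : a ≠ o)
    (hbo : b ≠ o) (hco : c ≠ o) (hab : a ≠ b) (hac : a ≠ c) (hbc : b ≠ c)
    (hobs : ∀ u, u ≠ o → u ≠ a → u ≠ b → u ≠ c → w s(o, u) = 0)
    (hhalf : (1 / 2 : ℝ) ≤ w s(o, a) ∨ (1 / 2 : ℝ) ≤ w s(o, b) ∨ (1 / 2 : ℝ) ≤ w s(o, c))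
    (hqab : (prodBernoulli w).real (openConn o a) ≤ (prodBernoulli w).real (openConn o b))
    (hqac : (prodBernoulli w).real (openConn o a) ≤ (prodBernoulli w).real (openConn o c)) :
    (prodBernoulli w).real {ω | ω ∈ openConn o a ∧ ω ∉ openConn o b ∧ ω ∉ openConn o c} ≤
      (prodBernoulli w).real {ω | ω ∉ openConn o a ∧ ω ∈ openConn o b ∧ ω ∈ openConn o c} := by
  have hobs_b : ∀ u, u ≠ o → u ≠ b → u ≠ a → u ≠ c → w s(o, u) = 0 :=
    fun u huo hub hua huc => hobs u huo hua hub huc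
  have hobs_c : ∀ u, u ≠ o → u ≠ c → u ≠ a → u ≠ b → w s(o, u) = 0 :=
    fun u huo huc hua hub => hobs u huo hua hub huc
  by_cases hαβ : (w s(o, a) : ℝ) ≤ w s(o, b)
  · by_cases hαγ : (w s(o, a) : ℝ) ≤ w s(o, c)
    · -- `a` carries the lightest hair
      refine single_le_pair_of_half_le w o a b c hao hbo hco hab hac hbc hobs hαβ hαγ ?_
      rcases hhalf with h | h | h
      · exact Or.inl (h.trans hαβ)
      · exact Or.inl h
      · exact Or.inr h
    · -- `c` carries the lightest hair
      push Not at hαγ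
      have hγα : (w s(o, c) : ℝ) ≤ w s(o, a) := hαγ.le
      have hγβ : (w s(o, c) : ℝ) ≤ w s(o, b) := hγα.trans hαβ
      have hh : (1 / 2 : ℝ) ≤ w s(o, a) ∨ (1 / 2 : ℝ) ≤ w s(o, b) := by
        rcases hhalf with h | h | h
        · exact Or.inl h
        · exact Or.inr h
        · exact Or.inl (h.trans hγα)
      have h' := single_le_pair_of_half_le w o c a b hco hao hbo hac.symm hbc.symm hab hobs_c hγα hγβ hh
      have hca := OneCutFive.pocketExchange_of_le_of_exchange w o a c b hqac h'
      have e1 : {ω : BondConfig (Fin n) | ω ∈ openConn o a ∧ ω ∉ openConn o c ∧ ω ∉ openConn o b} =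
          {ω | ω ∈ openConn o a ∧ ω ∉ openConn o b ∧ ω ∉ openConn o c} := by
        ext ω; simp only [mem_setOf_eq]; tauto
      have e2 : {ω : BondConfig (Fin n) | ω ∉ openConn o a ∧ ω ∈ openConn o c ∧ ω ∈ openConn o b} =
          {ω | ω ∉ openConn o a ∧ ω ∈ openConn o b ∧ ω ∈ openConn o c} := by
        ext ω; simp only [mem_setOf_eq]; tauto
      rw [e1, e2] at hca
      exact hca
  · -- `b` carries the lightest hair (or is lighter than `a`)
    push Not at hαβ
    have hβα : (w s(o, b) : ℝ) ≤ w s(o, a) := hαβ.le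
    by_cases hβγ : (w s(o, b) : ℝ) ≤ w s(o, c)
    · have hh : (1 / 2 : ℝ) ≤ w s(o, a) ∨ (1 / 2 : ℝ) ≤ w s(o, c) := by
        rcases hhalf with h | h | h
        · exact Or.inl h
        · exact Or.inl (h.trans hβα)
        · exact Or.inr h
      have h' := single_le_pair_of_half_le w o b a c hbo hao hco hab.symm hbc hac hobs_b hβα hβγ hh
      exact OneCutFive.pocketExchange_of_le_of_exchange w o a b c hqab h'
    · -- `c` carries the lightest hair
      push Not at hβγ
      have hγβ : (w s(o, c) : ℝ) ≤ w s(o, b) := hβγ.le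
      have hγα : (w s(o, c) : ℝ) ≤ w s(o, a) := hγβ.trans hβα
      have hh : (1 / 2 : ℝ) ≤ w s(o, a) ∨ (1 / 2 : ℝ) ≤ w s(o, b) := by
        rcases hhalf with h | h | h
        · exact Or.inl h
        · exact Or.inr h
        · exact Or.inl (h.trans hγα)
      have h' := single_le_pair_of_half_le w o c a b hco hao hbo hac.symm hbc.symm hab hobs_c hγα hγβ hh
      have hca := OneCutFive.pocketExchange_of_le_of_exchange w o a c b hqac h'
      have e1 : {ω : BondConfig (Fin n) | ω ∈ openConn o a ∧ ω ∉ openConn o c ∧ ω ∉ openConn o b} =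
          {ω | ω ∈ openConn o a ∧ ω ∉ openConn o b ∧ ω ∉ openConn o c} := by
        ext ω; simp only [mem_setOf_eq]; tauto
      have e2 : {ω : BondConfig (Fin n) | ω ∉ openConn o a ∧ ω ∈ openConn o c ∧ ω ∈ openConn o b} =
          {ω | ω ∉ openConn o a ∧ ω ∈ openConn o b ∧ ω ∈ openConn o c} := by
        ext ω; simp only [mem_setOf_eq]; tauto
      rw [e1, e2] at hca
      exact hca

omit hao hbo hco hab hac hbc hobs in
/-- **The three-point row implied by `Z(3,2)` (necessity direction of the three-port reduction).**
If `OneCutFive.ZeroOneThree` holds, then for every finite weighted graph read off a three-port observer `o` (hairs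
`α, β, γ` to `a, b, c`, every other pair at `o` of weight `0`; three-point law `U0, Uab, Uac, Ubc, U3` of `(a,b,c)`
OFF `o`), the hypotheses of `Z(3,2)` — written out by `real_openConn` (`μ(o↔a) = α + (1−α)(β·Uab + γ·Uac + (β+γ−βγ)·U3)`
etc.) — force `0 ≤ U0·[(1−α)βγ − α(1−β)(1−γ)] + Ubc·[β+γ−βγ−α]`.  Since the graph off `o` and the three hairs are
arbitrary, this is a statement about ALL three-point connectivity laws of bond percolation: for hairs `< 1/2` with
`α` close to `β+γ−βγ` it is a LOWER bound on the apex-pair cells `Uab + Uac` of the other two vertices (see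
`zeroOneThree_threePoint_row`), of the type of Gladkov's Conjecture 10.1 with a LINEAR rate, where the printed
Theorem 1.3 [cite: Gladkov2024, Thm. 1.3 (p. 2) and Conj. 10.1 (p. 18)] (tree: `gladkov2024_thm_1_3_rate_max`,
`P(abc)·P(a|b|c)² ≤ 4·max(P(ab|c), P(ac|b))`) gives only a cubic one.  HONEST LABEL: conditional on the OPEN row
`ZeroOneThree`; nothing here asserts it. [this work] -/
theorem zeroOneThree_threePort (hZ : OneCutFive.ZeroOneThree) (w : Sym2 (Fin n) → unitInterval) (o a b c : Fin n)
    (hao : a ≠ o) (hbo : b ≠ o) (hco : c ≠ o) (hab : a ≠ b) (hac : a ≠ c) (hbc : b ≠ c)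
    (hobs : ∀ u, u ≠ o → u ≠ a → u ≠ b → u ≠ c → w s(o, u) = 0)
    (hsum : 2 < (prodBernoulli w).real (openConn o a) + (prodBernoulli w).real (openConn o b) +
      (prodBernoulli w).real (openConn o c))
    (hqab : (prodBernoulli w).real (openConn o a) ≤ (prodBernoulli w).real (openConn o b))
    (hqac : (prodBernoulli w).real (openConn o a) ≤ (prodBernoulli w).real (openConn o c)) :
    0 ≤ (prodBernoulli w).real {ω | ¬ (openGraph (ω ∩ {e | o ∉ e})).Reachable a b ∧
          ¬ (openGraph (ω ∩ {e | o ∉ e})).Reachable a c ∧ ¬ (openGraph (ω ∩ {e | o ∉ e})).Reachable b c} *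
          ((1 - w s(o, a)) * w s(o, b) * w s(o, c) - w s(o, a) * (1 - w s(o, b)) * (1 - w s(o, c))) +
        (prodBernoulli w).real {ω | (openGraph (ω ∩ {e | o ∉ e})).Reachable b c ∧
          ¬ (openGraph (ω ∩ {e | o ∉ e})).Reachable a b} *
          (w s(o, b) + w s(o, c) - w s(o, b) * w s(o, c) - w s(o, a)) := by
  have hex := OneCutFive.pocketExchange_of_zeroOneThree hZ w o a b c hab hac hbc hsum hqab hqac
  have hm := margin_eq w o a b c hao hbo hco hab hac hbc hobs
  linarith

omit hao hbo hco hab hac hbc hobs in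
/-- **The three-point row implied by `Z(3,2)`, in closed form.**  With real names for the three hairs
`α, β, γ ∈ [0,1]` and the five cells `U0, Uab, Uac, Ubc, U3` of the three-point law of `(a,b,c)` off the three-port
observer `o`: if `ZeroOneThree` holds then
`2 < Σ_v q_v`, `q_a ≤ q_b`, `q_a ≤ q_c` ⟹ `0 ≤ U0·[(1−α)βγ − α(1−β)(1−γ)] + Ubc·[β+γ−βγ−α]`, where
`q_a = α + (1−α)(β·Uab + γ·Uac + (β+γ−βγ)·U3)`, `q_b = β + (1−β)(α·Uab + γ·Ubc + (α+γ−αγ)·U3)`,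
`q_c = γ + (1−γ)(α·Uac + β·Ubc + (α+β−αβ)·U3)`.  A single weighted graph and hair triple violating this would refute
`Z(3,2)` (`not_zeroOneThree_of_threePort_witness`); numerically (memo FINDING-gen9-THREEPORT.md) the rows of
Gladkov–Zimin Thm. 4.6 and Gladkov Lemma 1.2 / Thm. 1.3 (all in the tree) do NOT imply it, while it follows from them
plus any apex-pair lower bound `Uab + Uac ≥ 0.3·U0·U3`. [this work; cite: Gladkov2024, Conj. 10.1 (p. 18)] -/
theorem zeroOneThree_threePoint_row (hZ : OneCutFive.ZeroOneThree) (w : Sym2 (Fin n) → unitInterval)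
    (o a b c : Fin n) (hao : a ≠ o) (hbo : b ≠ o) (hco : c ≠ o) (hab : a ≠ b) (hac : a ≠ c) (hbc : b ≠ c)
    (hobs : ∀ u, u ≠ o → u ≠ a → u ≠ b → u ≠ c → w s(o, u) = 0)
    {α β γ U0 Uab Uac Ubc U3 : ℝ} (hα : α = w s(o, a)) (hβ : β = w s(o, b)) (hγ : γ = w s(o, c))
    (hU0 : U0 = (prodBernoulli w).real {ω | ¬ (openGraph (ω ∩ {e | o ∉ e})).Reachable a b ∧
      ¬ (openGraph (ω ∩ {e | o ∉ e})).Reachable a c ∧ ¬ (openGraph (ω ∩ {e | o ∉ e})).Reachable b c})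
    (hUab : Uab = (prodBernoulli w).real {ω | (openGraph (ω ∩ {e | o ∉ e})).Reachable a b ∧
      ¬ (openGraph (ω ∩ {e | o ∉ e})).Reachable a c})
    (hUac : Uac = (prodBernoulli w).real {ω | (openGraph (ω ∩ {e | o ∉ e})).Reachable a c ∧
      ¬ (openGraph (ω ∩ {e | o ∉ e})).Reachable a b})
    (hUbc : Ubc = (prodBernoulli w).real {ω | (openGraph (ω ∩ {e | o ∉ e})).Reachable b c ∧
      ¬ (openGraph (ω ∩ {e | o ∉ e})).Reachable a b})
    (hU3 : U3 = (prodBernoulli w).real {ω | (openGraph (ω ∩ {e | o ∉ e})).Reachable a b ∧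
      (openGraph (ω ∩ {e | o ∉ e})).Reachable a c})
    (hsum : 2 < (α + (1 - α) * (β * Uab + γ * Uac + (β + γ - β * γ) * U3)) +
      (β + (1 - β) * (α * Uab + γ * Ubc + (α + γ - α * γ) * U3)) +
      (γ + (1 - γ) * (α * Uac + β * Ubc + (α + β - α * β) * U3)))
    (hqab : α + (1 - α) * (β * Uab + γ * Uac + (β + γ - β * γ) * U3) ≤
      β + (1 - β) * (α * Uab + γ * Ubc + (α + γ - α * γ) * U3))
    (hqac : α + (1 - α) * (β * Uab + γ * Uac + (β + γ - β * γ) * U3) ≤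
      γ + (1 - γ) * (α * Uac + β * Ubc + (α + β - α * β) * U3)) :
    0 ≤ U0 * ((1 - α) * β * γ - α * (1 - β) * (1 - γ)) + Ubc * (β + γ - β * γ - α) := by
  have ea := real_openConn w o a b c hao hbo hco hab hac hbc hobs
  have eb := real_openConn_b w o a b c hao hbo hco hab hac hbc hobs
  have ec := real_openConn_c w o a b c hao hbo hco hab hac hbc hobs
  rw [← hα, ← hβ, ← hγ, ← hUab, ← hUac, ← hU3] at ea
  rw [← hα, ← hβ, ← hγ, ← hUab, ← hUbc, ← hU3] at eb
  rw [← hα, ← hβ, ← hγ, ← hUac, ← hUbc, ← hU3] at ec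
  have h := zeroOneThree_threePort hZ w o a b c hao hbo hco hab hac hbc hobs (by rw [ea, eb, ec]; exact hsum)
    (by rw [ea, eb]; exact hqab) (by rw [ea, ec]; exact hqac)
  rw [← hα, ← hβ, ← hγ, ← hU0, ← hUbc] at h
  exact h
end Formulas

end ThreePort

end Summit.CriticalPhenomena.PercolationContinuityZ3.Theorems

end
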